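import Literature.AnabelianGeometry.EtaleTheta.FrobenioidThetaBiKummerOfModel
import Literature.AlgebraicGeometry.Frobenioids.CoAngular
import HarnessLib

/-!
# [EtTh] Prop. 5.2 (i) / Rmk. 4.3.2: «an `N`-th root of an `l`-th root of `Θ̈` IS an `l·N`-th root of `Θ̈`»
# — the composite-root structure, modulo EXACTLY the three closure inputs the §4 interface lacks

S. Mochizuki, *The étale theta function …*, Publ. RIMS **45** (2009), Prop. 5.2 (i) p. 324 (PDF p. 98)
«constitutes an `l·N`-th root of a right fraction-pair of `Θ̈`, or, alternatively, an `N`-th root of a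
right fraction-pair of an `l`-th root of `Θ̈` [cf. Remark 4.3.2]», Rmk. 4.3.2 pp. 318–319 (PDF pp. 92–93),
Prop. 4.2 (iii) p. 314 (PDF p. 88) [cite: MochizukiEtTh2009, Prop 5.2 (i) p.324 (PDF p.98)]. Cell abc-iut,
layer L2; GAP-LEDGER row G-L2t4-1 (binder `hcomp` of
`ThetaFrobenioid.thetaPairIsRoot_ofBiKummerData`, abc-iut-L2-t4); ROW #5 = L2-lead gen 3 RULINGS #6-R53 to
seat abc-iut-w5-d234 (gen 2), in the HONEST SHAPE stated by the row author (INBOX 2026-08-26T05:01:17Z):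
over abc-iut-L2-t3's ABSTRACT `BiKummerSetting` (Def. 4.1) the composite of the two root diagrams of
Prop. 4.2 (iii) — `Rl` (an `l`-th root of a fraction-pair `Pl` of `θ`) and `R` (an `N`-th root of the
root's pair) — IS an `l·N`-th root of `Pl` (`NthRoot.comp`, hence `hcomp_of : PairIsNthRootOf pullFrac (l·N) θ
R.pair.num R.pair.den`), with EVERYTHING that composes PROVED (objects, arrows, the two commutative squares,
isometry and Frobenius degree of the composites via the tree's `PreFrobenioid.IsIsometry.comp` /
`PreFrobenioid.degFr_comp`, the root and its pair, the power law `f_N^{l·N} = θ|`) and EXACTLY the three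
interface-invisible inputs as NAMED binders (no `def … : Prop`):
* (C1) `D : S.BaseFrobeniusTypeData (R.α ≫ Rl.α)` — base-Frobenius-type data for the COMPOSITE `A_{lN} → A`
  (Def. 4.1 (iv): an Aut-lifting of `Gal(A_{lN}^bs/A^bs)`, `μ_{lN}`-saturation, a factorisation `α'' ≫ α'`
  with (c)(d)(e); over the abstract predicates `IsPullback`/`IsFrobeniusType`/`ArisesFromBaseFrobeniusPair`
  this is [FrdI] Def. 1.3's factorisation in a Frobenioid — GAP sub-row G-L2t4-1a), together with
  (C1′) `hD : pullFrac D.α₁ θ = pullFrac R.αData.α₁ (pullFrac Rl.αData.α₁ θ)` — its pull-back factor pulls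
  `θ` back THROUGH `A_l` (in print `α'_{lN} = α'_l ∘ (…)`, [FrdI] Prop. 1.11 (iv) functoriality of `(·)^*`);
* (C2) `hsat : S.IsSaturated R.AN (l·N) (pullFrac D.α₁ θ)` — `(l·N, H_⊙)`-saturation of `A_{lN}` (not
  implied by `(l,H)` + `(N,H)`; G-L2t4-1b);
* (C3) `hpow : ∀ x n, pullFrac R.αData.α₁ (x ^ n) = pullFrac R.αData.α₁ x ^ n` — multiplicativity of the
  pull-back of birational units ([FrdI] Prop. 1.11 (iv); a THEOREM for abc-iut-L2-t9's `pullFracModel`,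
  a binder over the abstract `pullFrac`; G-L2t4-1c).
Print CHOOSES the roots compatibly (take the `l·N`-th root first, then factor — Rmk. 4.3.2 «cofinal
compatible choice»), which is why (C1)/(C2) are inputs on the pair `(Rl, R)` and not consequences.
HONEST FRAMING: kernel bookkeeping over a refereed text; typed ≠ proved for the abstract interface; nothing
here bears on the disputed [IUTchIII] Cor. 3.12.
-/

noncomputable section

namespace Literature.AnabelianGeometry.EtaleTheta

open CategoryTheory Literature.AlgebraicGeometry.Frobenioids

universe u₀ v₀ u v w

variable {K : Type u₀} [Field K]

namespace BiKummerSetting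

variable {X : SemiGraphs.TemperedArithmeticGroup.{u₀} K} {D₀ : Type u₀} [Category.{v₀} D₀]
  {V : FrdIMonoidStub.{w}} {T : RealifiedDivisorMonoids (D₀ := D₀) V} {D : Type u} [Category.{v} D]
  {VD : FrdICatStub.{u, v, w} D} {S : BiKummerSetting X T D VD}
  {pullFrac : ∀ {A A' : S.C} (_ : A' ⟶ A), S.biratUnits A → S.biratUnits A'}

namespace NthRoot

variable {A Bl : S.C} {θ : S.biratUnits A} {Pl : S.FractionPair θ Bl} {lv N : ℕ+}
  (Rl : S.NthRoot θ Pl lv pullFrac) (R : S.NthRoot Rl.root Rl.pair N pullFrac)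

/-- The power law of the composite root: `f_N^{l·N} = θ|_{A_{lN}}` — from `f_N^N = f_l|_{A_{lN}}`
(`R.pow_root`), `f_l^l = θ|_{A_l}` (`Rl.pow_root`), multiplicativity of the pull-back (C3) and the
compatibility (C1′) of the composite pull-back factor. [cite: MochizukiEtTh2009, Rmk 4.3.2 p.318 (PDF p.92)] -/
theorem pow_root_comp (D : S.BaseFrobeniusTypeData (R.α ≫ Rl.α))
    (hD : pullFrac D.α₁ θ = pullFrac R.αData.α₁ (pullFrac Rl.αData.α₁ θ))
    (hpow : ∀ (x : S.biratUnits Rl.AN) (n : ℕ), pullFrac R.αData.α₁ (x ^ n) = pullFrac R.αData.α₁ x ^ n) :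
    R.root ^ ((lv * N : ℕ+) : ℕ) = pullFrac D.α₁ θ := by
  rw [hD, ← Rl.pow_root, hpow, ← R.pow_root, ← pow_mul, PNat.mul_coe, mul_comm]

/-- **The COMPOSITE root structure** (Rmk. 4.3.2 / Prop. 5.2 (i), first alternative): from an `l`-th root
`Rl = (A_l, B_l, α_l, β_l, f_l, (s'_l, s''_l))` of a right fraction-pair `Pl` of `θ` and an `N`-th root
`R = (A_{lN}, B_{lN}, α_N, β_N, f_N, (s'_N, s''_N))` of the pair `(s'_l, s''_l)` of `f_l`, the diagram
`(A_{lN}, B_{lN}, α_N ≫ α_l, β_N ≫ β_l, f_N, (s'_N, s''_N))` is an `l·N`-th root of `Pl` — given the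
base-Frobenius-type datum of the composite (C1, C1′), the `(l·N)`-saturation (C2) and multiplicativity of
the pull-back (C3). Everything else is PROVED: the squares paste, isometries compose
(`PreFrobenioid.IsIsometry.comp`), Frobenius degrees multiply (`PreFrobenioid.degFr_comp`), the root powers
to `θ|` (`pow_root_comp`). [cite: MochizukiEtTh2009, Prop 5.2 (i) p.324 (PDF p.98)] -/
def comp (D : S.BaseFrobeniusTypeData (R.α ≫ Rl.α))
    (hD : pullFrac D.α₁ θ = pullFrac R.αData.α₁ (pullFrac Rl.αData.α₁ θ))
    (hsat : S.IsSaturated R.AN (lv * N) (pullFrac D.α₁ θ))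
    (hpow : ∀ (x : S.biratUnits Rl.AN) (n : ℕ), pullFrac R.αData.α₁ (x ^ n) = pullFrac R.αData.α₁ x ^ n) :
    S.NthRoot θ Pl (lv * N) pullFrac where
  AN := R.AN
  BN := R.BN
  α := R.α ≫ Rl.α
  β := R.β ≫ Rl.β
  root := R.root
  pair := R.pair
  comm_num := by rw [← Category.assoc, R.comm_num, Category.assoc, Rl.comm_num, Category.assoc]
  comm_den := by rw [← Category.assoc, R.comm_den, Category.assoc, Rl.comm_den, Category.assoc]
  isIsometry := by
    obtain ⟨hα, hβ, hdα, hdβ⟩ := R.isIsometry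
    obtain ⟨hαl, hβl, hdαl, hdβl⟩ := Rl.isIsometry
    refine ⟨Literature.AlgebraicGeometry.Frobenioids.PreFrobenioid.IsIsometry.comp S.F hα hαl,
      Literature.AlgebraicGeometry.Frobenioids.PreFrobenioid.IsIsometry.comp S.F hβ hβl, ?_, ?_⟩
    · change Literature.AlgebraicGeometry.Frobenioids.PreFrobenioid.degFr S.F (R.α ≫ Rl.α) = lv * N
      rw [Literature.AlgebraicGeometry.Frobenioids.PreFrobenioid.degFr_comp]
      change S.degFr R.α * S.degFr Rl.α = lv * N
      rw [hdα, hdαl, mul_comm]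
    · change Literature.AlgebraicGeometry.Frobenioids.PreFrobenioid.degFr S.F (R.β ≫ Rl.β) = lv * N
      rw [Literature.AlgebraicGeometry.Frobenioids.PreFrobenioid.degFr_comp]
      change S.degFr R.β * S.degFr Rl.β = lv * N
      rw [hdβ, hdβl, mul_comm]
  αData := D
  pow_root := pow_root_comp Rl R D hD hpow
  isSaturated := hsat

/-- The composite root has the SAME root element and root pair as `R`. [cite: MochizukiEtTh2009, Rmk 4.3.2 p.318 (PDF p.92)] -/
theorem comp_pair (D : S.BaseFrobeniusTypeData (R.α ≫ Rl.α))
    (hD : pullFrac D.α₁ θ = pullFrac R.αData.α₁ (pullFrac Rl.αData.α₁ θ))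
    (hsat : S.IsSaturated R.AN (lv * N) (pullFrac D.α₁ θ))
    (hpow : ∀ (x : S.biratUnits Rl.AN) (n : ℕ), pullFrac R.αData.α₁ (x ^ n) = pullFrac R.αData.α₁ x ^ n) :
    (comp Rl R D hD hsat hpow).pair = R.pair ∧ (comp Rl R D hD hsat hpow).root = R.root :=
  ⟨rfl, rfl⟩

/-- **G-L2t4-1 `hcomp` in its honest shape**: «an `N`-th root of an `l`-th root of `Θ̈` IS an `l·N`-th root
of (a right fraction-pair of) `Θ̈`» — the root pair `(s'_N, s''_N)` of `R` constitutes an `l·N`-th root of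
a right fraction-pair of `θ` (`PairIsNthRootOf`, the first alternative of Prop. 5.2 (i)), modulo exactly the
closure inputs (C1, C1′), (C2), (C3). [cite: MochizukiEtTh2009, Prop 5.2 (i) p.324 (PDF p.98)] -/
theorem hcomp_of (D : S.BaseFrobeniusTypeData (R.α ≫ Rl.α))
    (hD : pullFrac D.α₁ θ = pullFrac R.αData.α₁ (pullFrac Rl.αData.α₁ θ))
    (hsat : S.IsSaturated R.AN (lv * N) (pullFrac D.α₁ θ))
    (hpow : ∀ (x : S.biratUnits Rl.AN) (n : ℕ), pullFrac R.αData.α₁ (x ^ n) = pullFrac R.αData.α₁ x ^ n) :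
    S.PairIsNthRootOf pullFrac ((lv : ℕ) * (N : ℕ)) θ R.pair.num R.pair.den :=
  ⟨Nat.mul_pos lv.pos N.pos, Bl, Pl, comp Rl R D hD hsat hpow, Iso.refl _, Iso.refl _, by simp [comp],
    by simp [comp]⟩

end NthRoot

end BiKummerSetting

end Literature.AnabelianGeometry.EtaleTheta

end
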